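import Summits.CriticalPhenomena.PercolationContinuityZ3.Theorems.PercNearOneGluingNoHeavyLowerTailThreePointProductFormBoxPair

/-!
# The box theorem: the OUTER-CONE reduction (architecture III of prover prim-sahi-p2 gen 73)

Support file (`--supports stmt-CriticalPhenomena-4575`).  Standard axioms, no sorries, no named facts.  Memo
`run/shared/lean/prim/prim-sahi/FROM-prim-sahi-p2-gen73-OUTER-CONES.md`, `prim-sahi-p2/PROOF-E3.md` §83.

THE REDUCTION.  Split a physical cycle word as `w = u ++ z ++ v` with a MIDDLE word `z` of fixed length `m` and two OUTER words
`u, v` of length `≥ D`.  By the physical pair identity (`boxval_append`) and `brunA_append`,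
`A[w] = β_a(state(reverse u), N_z state(v)) + β_b(…)`, where both outer states are reachable states of depth `≥ D`.
Hence: if `K` is ANY property of states ("outer laws") that every reachable state of depth `≥ D` enjoys — each conjunct of `K`
may be proved separately, `K` need NOT be invariant under the letters — and if the pairing through every physical middle word of
length `m` is nonnegative on `K × K` ("copositivity", a finite-dimensional statement for fixed `m`), then `A[w] ≥ 0` for every
physical word of length `≥ m + 2D` (`boxval_nonneg_of_outerLaws`).  The words of length `< m + 2D` are covered by the kernel
theorems `boxval_nonneg_of_length_le_seven` (k ≤ 7) and the exact certificates k ≤ 15 (memo).  The memo records the no-go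
(no POLYHEDRAL `K` can satisfy the copositivity hypothesis, for any `m`) and the numerical evidence that the proved cones
`K_ψ`, `K_Λ`, the cross/column-domination LMIs together with ONE hyperbolic law `ℓ(c₃)² ≤ C·ℓ(−m₊)·ℓ(−m₋)` and one Schur law
for `ζ` pass the limiting (`m → ∞`) form of the copositivity test.
[this work] (gen 73).
-/

namespace Summit.CriticalPhenomena.PercolationContinuityZ3.Theorems.ProductFormABPlus

/-! ### The outer-cone reduction -/

/-- Splitting a list into a prefix of length `D`, a middle of length `m` and the rest. [this work] -/
theorem take_drop_three (w : List (ℚ × ℚ)) (D m : ℕ) :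
    w = w.take D ++ ((w.drop D).take m ++ (w.drop D).drop m) := by
  rw [List.take_append_drop, List.take_append_drop]

/-- ★ THE OUTER-CONE REDUCTION (architecture III).  Let `K` be any property of pairs of `a`/`b`-states that holds for the state of
every physical word of length `≥ D` ("outer laws"), and suppose that for all `K`-states `a, b` and every physical middle word `z`
of length `m` the Krein pairing `β_a(a, N_z b) + β_b(a, N_z b)` is nonnegative ("copositivity through a middle word").  Then the AM
form `boxval w` is nonnegative for every physical word of length `≥ m + 2·D`. [this work] -/
theorem boxval_nonneg_of_outerLaws (K : StA → StB → Prop) (D m : ℕ)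
    (hK : ∀ w : List (ℚ × ℚ), (∀ θ ∈ w, 0 ≤ θ.1 + θ.2 ∧ 0 ≤ θ.1 - θ.2) → D ≤ w.length →
      K (brunA w omegaA) (brunB w omegaB))
    (hC : ∀ (aA : StA) (aB : StB) (bA : StA) (bB : StB), K aA aB → K bA bB →
      ∀ z : List (ℚ × ℚ), (∀ θ ∈ z, 0 ≤ θ.1 + θ.2 ∧ 0 ≤ θ.1 - θ.2) → z.length = m →
        0 ≤ kA aA (brunA z bA) + kB aB (brunB z bB))
    (w : List (ℚ × ℚ)) (hw : ∀ θ ∈ w, 0 ≤ θ.1 + θ.2 ∧ 0 ≤ θ.1 - θ.2) (hlen : m + 2 * D ≤ w.length) :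
    0 ≤ boxval w := by
  set u := w.take D with hu
  set z := (w.drop D).take m with hz
  set v := (w.drop D).drop m with hv
  have hsplit : w = u ++ (z ++ v) := take_drop_three w D m
  have hphys := hw
  rw [hsplit] at hphys
  obtain ⟨hpu, hpzv⟩ := physical_append_iff.mp hphys
  obtain ⟨hpz, hpv⟩ := physical_append_iff.mp hpzv
  have hDle : D ≤ w.length := by omega
  have hlu : u.length = D := by
    rw [hu, List.length_take]; exact Nat.min_eq_left hDle
  have hlz : z.length = m := by
    rw [hz, List.length_take, List.length_drop]
    exact Nat.min_eq_left (by omega)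
  have hlv : D ≤ v.length := by
    rw [hv, List.length_drop, List.length_drop]; omega
  have hKu : K (brunA u.reverse omegaA) (brunB u.reverse omegaB) :=
    hK u.reverse (physical_reverse hpu) (by rw [List.length_reverse, hlu])
  have hKv : K (brunA v omegaA) (brunB v omegaB) := hK v hpv hlv
  rw [hsplit, boxval_append, brunA_append, brunB_append]
  exact hC _ _ _ _ hKu hKv z hpz hlz

/-- The same reduction with NO middle word (`m = 0`): if the outer laws `K` hold from depth `D` and the Krein pairing is
nonnegative on `K × K`, then `boxval w ≥ 0` for every physical word of length `≥ 2·D`. [this work] -/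
theorem boxval_nonneg_of_outerLaws_pairing (K : StA → StB → Prop) (D : ℕ)
    (hK : ∀ w : List (ℚ × ℚ), (∀ θ ∈ w, 0 ≤ θ.1 + θ.2 ∧ 0 ≤ θ.1 - θ.2) → D ≤ w.length →
      K (brunA w omegaA) (brunB w omegaB))
    (hC : ∀ (aA : StA) (aB : StB) (bA : StA) (bB : StB), K aA aB → K bA bB → 0 ≤ kA aA bA + kB aB bB)
    (w : List (ℚ × ℚ)) (hw : ∀ θ ∈ w, 0 ≤ θ.1 + θ.2 ∧ 0 ≤ θ.1 - θ.2) (hlen : 2 * D ≤ w.length) :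
    0 ≤ boxval w := by
  refine boxval_nonneg_of_outerLaws K D 0 hK ?_ w hw (by omega)
  intro aA aB bA bB ha hb z _ hz
  have : z = [] := List.length_eq_zero_iff.mp hz
  subst this
  simpa [brunA, brunB] using hC aA aB bA bB ha hb

/-- Monotonicity in the cut: moving one physical letter `θ` from the middle word into the right outer state.  With
`boxval_append` this is the associativity `N_{z ++ [θ]} b = N_z (N_θ b)` used when the copositivity hypothesis is verified
for a longer middle word by peeling letters onto outer states that satisfy INVARIANT laws. [this work] -/
theorem brunA_middle_snoc (z : List (ℚ × ℚ)) (θ : ℚ × ℚ) (b : StA) :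
    brunA (z ++ [θ]) b = brunA z (bstepA θ.1 θ.2 b) := by
  rw [brunA_append]; rfl

end Summit.CriticalPhenomena.PercolationContinuityZ3.Theorems.ProductFormABPlus
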